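import Mathlib.FieldTheory.IsAlgClosed.Basic
import Mathlib.Algebra.Polynomial.Splits
import Mathlib.Algebra.Algebra.Hom.Rat
import Mathlib.RingTheory.Algebraic.Basic
import Literature.FieldTheory.FunctionField.RationalClosedPointOrdersConstantExtension
import Literature.IUT.HodgeTheaters.Ex54ivInfKappaArithRatGalois
import Literature.IUT.HodgeTheaters.KappaCoricRatGaloisRestriction
import HarnessLib

/-!
# [IUTchI] Remark 3.1.7 (i), (ii) under base change: `κ`-coricity with GEOMETRIC divisors is
# stable along a field embedding (GAP B, item GB-06: clause (a) of [IUTchI] Example 5.4 (iv))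

S. Mochizuki, *Inter-universal Teichmüller theory I*, §3, Rmk 3.1.7 (i), (ii) (kurims manuscript
May 2020, pp. 66–68) and §5, Ex. 5.4 (iv) (p. 149: "such a poly-morphism `‡ℱ → †ℱ^⊚` is compatible
with the local and global `∞κ`-coric structures") [claim: Mochizuki2012, status: disputed] — cell
abc-iut, GAP B = G-L5t9g8-1, item GB-06 = row D5 (clause (a), GEOMETRIC) of `GAP-SIZING-B.md`
2de24246389ab103; RULINGS #318 of the L5 chair (divisors GEOMETRIC, never `ClauseANaive`).

**Content (elementary field theory, PROVED).** `φ : Ω →+* Ω'` a homomorphism of fields of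
characteristic `0`; `ψ = ratFuncMapCoeffs φ : Ω(t) →+* Ω'(t)` the TREE's constant-field extension
(`Literature.FieldTheory.FunctionField`, Chevalley VI §6; `num_/denom_ratFuncMapCoeffs` REUSED) —
by `ratFuncHom_eq_ratFuncMapCoeffs` it is THE ring hom acting as `φ` on constants and fixing `t`
(the `ψ` of any GAP-SIZING-B base-change square). For `f ∈ Ω(t)` whose normalised numerator and
denominator SPLIT over `Ω` — automatic for `Ω` algebraically closed, i.e. divisors counted
GEOMETRICALLY as in print ("over `L̄`"): `zeroes (ψ f) = φ (zeroes f)`, `poles (ψ f) = φ (poles f)`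
as finite SETS (`Polynomial.Splits.roots_map`), same cardinalities; `(ψ f)(φ e) = φ (f(e))`; HENCE
`f` `κ`-coric for `S` (L5-t2's `CriticalLocus.IsKappaCoric`) IFF `ψ f` `κ`-coric for any
transported locus `S'` (`S'.pts = φ (S.pts)`: the sketch's `critMap S φ` l.41 by `rfl`, GB-02's
`toGeom`, GB-04's locus), and forward transport of `∞κ`-coric / `∞κ×`-coric / `κ`-solvable, and of
the general `∞κ`-coric elements of `Λ ⊇ Ω(t)` (`CriticalLocus.IsInftyKappaCoricIn`) along any
`ι : Λ →+* Λ'` over `ψ` (e.g. GB-03's `RatBaseChange.iota φ`, `iota_algebraMap`):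
`mapsTo_isInftyKappaCoricIn_of_isAlgClosed` is clause (a) of Ex. 5.4 (iv) ("restriction of Kummer
classes lands in `‡𝕄_{∞κv}`") = the BODY of the sketch's `ClauseAGeom` (`GapSizingBSketch.lean`
l.74) over its fields `φ, ψ, ψ_C, ψ_X, ι, ι_comm`; ruled name `isKappaCoric_map_of_isAlgClosed`
(generic `ψ`); intended `Ω ⊇ F̄` algebraically closed, `Ω' ⊇ K̄_v`, `ι = ι_v`.

**Design (RULINGS #318, ERRATA I-124).** `CriticalLocus.zeroes/poles` count roots IN `Ω`; at a
non-algebraically-closed `Ω` "precisely one pole, at least two zeroes" is NOT base-change stable, so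
the NAIVE typing at `Ω = F_mod → K_v` is refutable and is NOT built. Hypotheses are the sharp ones
(`f.num.Splits ∧ f.denom.Splits`, discharged by `IsAlgClosed.splits`); `Ω'` is ANY char-`0` field.
NOT here: the record `BaseChangeSquare` / `critMap` as definitions (GB-03 / GB-04 binders; the
bundled `ClauseAGeom S B` is a one-liner from `mapsTo_isInftyKappaCoricIn_of_isAlgClosed`); clauses
(b)(c) (GB-03's `iota_ratHom_smul`, GB-12); `F_mod`, `K_v`, initial Θ-data. Honest framing: an
undisputed elementary construction; no side on [IUTchIII] Cor. 3.12; nothing asserted about abc.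
-/

namespace Literature.IUT.HodgeTheaters

open Polynomial Literature.FieldTheory.FunctionField
open scoped RatFunc

universe u v w w'

namespace CriticalLocus

variable {Ω : Type u} {Ω' : Type v} [Field Ω] [Field Ω']

/-! ### The constant-field extension `ψ = ratFuncMapCoeffs φ : Ω(t) → Ω'(t)` -/

/-- **Uniqueness of the base-change map on rational functions.** A ring homomorphism
`ψ : Ω(t) → Ω'(t)` acting as `φ` on constants and fixing the coordinate (the fields `ψ_C`, `ψ_X` of a
GAP-SIZING-B base-change square) IS the constant-field extension `ratFuncMapCoeffs φ` (Chevalley's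
`R⟨L⟩` is determined by `R` and `L`). [cite: ChevalleyAlgebraicFunctions1951, Ch. V §4] -/
theorem ratFuncHom_eq_ratFuncMapCoeffs (φ : Ω →+* Ω') (ψ : RatFunc Ω →+* RatFunc Ω')
    (hC : ∀ c : Ω, ψ (RatFunc.C c) = RatFunc.C (φ c)) (hX : ψ RatFunc.X = RatFunc.X) :
    ψ = ratFuncMapCoeffs φ := by
  apply IsLocalization.ringHom_ext (nonZeroDivisors (Polynomial Ω))
  refine Polynomial.ringHom_ext (fun c => ?_) ?_
  · simp only [RingHom.comp_apply, RatFunc.algebraMap_C, hC, ratFuncMapCoeffs_C]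
  · simp only [RingHom.comp_apply, RatFunc.algebraMap_X, hX, ratFuncMapCoeffs_X]

/-- Base change of a non-constant rational function is non-constant: if `ψ f = C c'` then already
`f = C c` for some `c` (helper; cf. the tree's `ratFuncMapCoeffs_ne_C`). [folklore] -/
private theorem forall_ne_C_of_ratFuncMapCoeffs (φ : Ω →+* Ω') {f : RatFunc Ω}
    (hf : ∀ c' : Ω', ratFuncMapCoeffs φ f ≠ RatFunc.C c') : ∀ c : Ω, f ≠ RatFunc.C c :=
  fun c h => hf (φ c) (by rw [h, ratFuncMapCoeffs_C])

/-- Evaluation commutes with base change: `(ψ f)(φ e) = φ (f(e))` (Mathlib's `RatFunc.eval`,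
which evaluates the normalised numerator and denominator; tree: `num_/denom_ratFuncMapCoeffs`): the
value at a place of degree one is unchanged by extension of the constant field.
[cite: ChevalleyAlgebraicFunctions1951, Ch. VI §6 Thm 11] -/
theorem eval_ratFuncMapCoeffs (φ : Ω →+* Ω') (f : RatFunc Ω) (e : Ω) :
    (ratFuncMapCoeffs φ f).eval (RingHom.id Ω') (φ e) = φ (f.eval (RingHom.id Ω) e) := by
  simp only [RatFunc.eval, map_div₀, num_ratFuncMapCoeffs, denom_ratFuncMapCoeffs,
    Polynomial.eval₂_map, RingHom.id_comp, Polynomial.eval₂_hom, Polynomial.eval₂_id]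

/-! ### Zeroes and poles as geometric point sets -/

/-- If the numerator of `f` splits over `Ω` (e.g. `Ω` algebraically closed), the zero SET of the
base change is the image of the zero set: `zeroes (ψ f) = φ (zeroes f)` (the divisor of `f` in
`R⟨L⟩` is the conorm of its divisor in `R`). [cite: ChevalleyAlgebraicFunctions1951, Ch. VI §6 Thm 11] -/
theorem zeroes_ratFuncMapCoeffs (φ : Ω →+* Ω') {f : RatFunc Ω} (hnum : f.num.Splits) :
    zeroes (ratFuncMapCoeffs φ f) = (zeroes f).map ⟨φ, φ.injective⟩ := by
  ext x
  simp only [zeroes, Multiset.mem_toFinset, Finset.mem_map, Function.Embedding.coeFn_mk,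
    num_ratFuncMapCoeffs, hnum.roots_map φ, Multiset.mem_map]

/-- If the denominator of `f` splits over `Ω` (e.g. `Ω` algebraically closed), the pole SET of the
base change is the image of the pole set: `poles (ψ f) = φ (poles f)` (conorm of the divisor of
poles). [cite: ChevalleyAlgebraicFunctions1951, Ch. VI §6 Thm 11] -/
theorem poles_ratFuncMapCoeffs (φ : Ω →+* Ω') {f : RatFunc Ω} (hden : f.denom.Splits) :
    poles (ratFuncMapCoeffs φ f) = (poles f).map ⟨φ, φ.injective⟩ := by
  ext x
  simp only [poles, Multiset.mem_toFinset, Finset.mem_map, Function.Embedding.coeFn_mk,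
    denom_ratFuncMapCoeffs, hden.roots_map φ, Multiset.mem_map]

/-! ### `κ`-coricity under base change (Rmk 3.1.7 (i)) -/

/-- "Avoids the critical points" is base-change stable along `φ`, for any transported strictly
critical locus `S'.pts = φ (S.pts)`. [claim: Mochizuki2012, status: disputed] -/
theorem AvoidsCritical.map_ratFuncMapCoeffs (φ : Ω →+* Ω') {S : CriticalLocus Ω}
    {S' : CriticalLocus Ω'} (hS : S'.pts = S.pts.map ⟨φ, φ.injective⟩) {f : RatFunc Ω}
    (hf : S.AvoidsCritical f) : S'.AvoidsCritical (ratFuncMapCoeffs φ f) where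
  num_eval_ne := fun e' he' => by
    rw [hS, Finset.mem_map] at he'
    obtain ⟨e, he, rfl⟩ := he'
    rw [Function.Embedding.coeFn_mk, num_ratFuncMapCoeffs, Polynomial.eval_map,
      Polynomial.eval₂_hom]
    exact (map_ne_zero φ).mpr (hf.num_eval_ne e he)
  denom_eval_ne := fun e' he' => by
    rw [hS, Finset.mem_map] at he'
    obtain ⟨e, he, rfl⟩ := he'
    rw [Function.Embedding.coeFn_mk, denom_ratFuncMapCoeffs, Polynomial.eval_map,
      Polynomial.eval₂_hom]
    exact (map_ne_zero φ).mpr (hf.denom_eval_ne e he)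
  natDegree_eq := by
    rw [num_ratFuncMapCoeffs, denom_ratFuncMapCoeffs, Polynomial.natDegree_map,
      Polynomial.natDegree_map, hf.natDegree_eq]

/-- Conversely, avoidance of the transported critical points DESCENDS along `φ` (a field hom is
injective and preserves degrees). [claim: Mochizuki2012, status: disputed] -/
theorem AvoidsCritical.of_ratFuncMapCoeffs (φ : Ω →+* Ω') {S : CriticalLocus Ω}
    {S' : CriticalLocus Ω'} (hS : S'.pts = S.pts.map ⟨φ, φ.injective⟩) {f : RatFunc Ω}
    (hf : S'.AvoidsCritical (ratFuncMapCoeffs φ f)) : S.AvoidsCritical f where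
  num_eval_ne := fun e he => by
    have h := hf.num_eval_ne (φ e) (by rw [hS]; exact Finset.mem_map.mpr ⟨e, he, rfl⟩)
    rwa [num_ratFuncMapCoeffs, Polynomial.eval_map, Polynomial.eval₂_hom, _root_.map_ne_zero] at h
  denom_eval_ne := fun e he => by
    have h := hf.denom_eval_ne (φ e) (by rw [hS]; exact Finset.mem_map.mpr ⟨e, he, rfl⟩)
    rwa [denom_ratFuncMapCoeffs, Polynomial.eval_map, Polynomial.eval₂_hom, _root_.map_ne_zero] at h
  natDegree_eq := by
    have h := hf.natDegree_eq
    rwa [num_ratFuncMapCoeffs, denom_ratFuncMapCoeffs, Polynomial.natDegree_map,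
      Polynomial.natDegree_map] at h

section KappaCoric

variable [CharZero Ω] [CharZero Ω']

/-- **Base-change stability of `κ`-coricity, sharp form.** If `f ∈ Ω(t)` is `κ`-coric for `S` and
its divisor SPLITS over `Ω`, then `ψ f ∈ Ω'(t)` is `κ`-coric for the transported locus `S'`: pole /
zero SETS by `Splits.roots_map`, algebraicity over `ℚ` by `IsAlgebraic.algHom` along `φ`, values at
the critical points by `(ψ f)(φ e) = φ (f(e))`. [claim: Mochizuki2012, status: disputed] -/
theorem IsKappaCoric.map_ratFuncMapCoeffs_of_splits (φ : Ω →+* Ω') {S : CriticalLocus Ω}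
    {S' : CriticalLocus Ω'} (hS : S'.pts = S.pts.map ⟨φ, φ.injective⟩) {f : RatFunc Ω}
    (hf : S.IsKappaCoric f) (hnum : f.num.Splits) (hden : f.denom.Splits) :
    S'.IsKappaCoric (ratFuncMapCoeffs φ f) where
  one_pole_two_zeroes := fun hc => by
    rw [poles_ratFuncMapCoeffs φ hden, zeroes_ratFuncMapCoeffs φ hnum, Finset.card_map,
      Finset.card_map]
    exact hf.one_pole_two_zeroes (forall_ne_C_of_ratFuncMapCoeffs φ hc)
  divisor_algebraic := fun z hz => by
    classical
    rw [zeroes_ratFuncMapCoeffs φ hnum, poles_ratFuncMapCoeffs φ hden] at hz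
    rcases Finset.mem_union.mp hz with hz | hz
    · obtain ⟨w, hw, rfl⟩ := Finset.mem_map.mp hz
      exact (hf.divisor_algebraic w (Finset.mem_union_left _ hw)).algHom φ.toRatAlgHom
    · obtain ⟨w, hw, rfl⟩ := Finset.mem_map.mp hz
      exact (hf.divisor_algebraic w (Finset.mem_union_right _ hw)).algHom φ.toRatAlgHom
  avoids := hf.avoids.map_ratFuncMapCoeffs φ hS
  rootOfUnity_at_critical := fun e' he' => by
    rw [hS, Finset.mem_map] at he'
    obtain ⟨e, he, rfl⟩ := he'
    obtain ⟨n, hn, h⟩ := hf.rootOfUnity_at_critical e he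
    refine ⟨n, hn, ?_⟩
    rw [Function.Embedding.coeFn_mk, eval_ratFuncMapCoeffs, ← map_pow, h, map_one]

/-- **Base-change stability of `κ`-coricity over algebraically closed `Ω` (RULINGS #318: divisors
GEOMETRIC).** Over an algebraically closed `Ω` of characteristic `0` (e.g. `Ω = F̄`), `κ`-coricity
of `f ∈ Ω(t)` for `S` implies `κ`-coricity of `ratFuncMapCoeffs φ f ∈ Ω'(t)` for the transported
locus `S'`, along ANY field homomorphism `φ : Ω →+* Ω'` into a field of characteristic `0`.
[claim: Mochizuki2012, status: disputed] -/
theorem isKappaCoric_ratFuncMapCoeffs_of_isAlgClosed [IsAlgClosed Ω] (φ : Ω →+* Ω')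
    {S : CriticalLocus Ω} {S' : CriticalLocus Ω'} (hS : S'.pts = S.pts.map ⟨φ, φ.injective⟩)
    {f : RatFunc Ω} (hf : S.IsKappaCoric f) : S'.IsKappaCoric (ratFuncMapCoeffs φ f) :=
  hf.map_ratFuncMapCoeffs_of_splits φ hS (IsAlgClosed.splits _) (IsAlgClosed.splits _)

/-- **Descent.** Conversely, if the divisor of `f` splits over `Ω` and the base change `ψ f` is
`κ`-coric for the transported locus, then `f` is `κ`-coric (`φ` is injective, so non-constancy,
algebraicity over `ℚ` — `isAlgebraic_algHom_iff` — and the root-of-unity values all descend).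
[claim: Mochizuki2012, status: disputed] -/
theorem IsKappaCoric.of_ratFuncMapCoeffs_of_splits (φ : Ω →+* Ω') {S : CriticalLocus Ω}
    {S' : CriticalLocus Ω'} (hS : S'.pts = S.pts.map ⟨φ, φ.injective⟩) {f : RatFunc Ω}
    (hf : S'.IsKappaCoric (ratFuncMapCoeffs φ f)) (hnum : f.num.Splits) (hden : f.denom.Splits) :
    S.IsKappaCoric f where
  one_pole_two_zeroes := fun hc => by
    have key := hf.one_pole_two_zeroes fun c' h => by
      obtain ⟨h1, h2⟩ := (RatFunc.eq_C_iff _).mp ⟨c', h⟩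
      rw [num_ratFuncMapCoeffs, Polynomial.natDegree_map] at h1
      rw [denom_ratFuncMapCoeffs, Polynomial.natDegree_map] at h2
      obtain ⟨c, hc'⟩ := (RatFunc.eq_C_iff f).mpr ⟨h1, h2⟩
      exact hc c hc'
    rwa [poles_ratFuncMapCoeffs φ hden, zeroes_ratFuncMapCoeffs φ hnum, Finset.card_map,
      Finset.card_map] at key
  divisor_algebraic := fun z hz => by
    classical
    refine (isAlgebraic_algHom_iff φ.toRatAlgHom φ.injective).mp (hf.divisor_algebraic (φ z) ?_)
    rw [zeroes_ratFuncMapCoeffs φ hnum, poles_ratFuncMapCoeffs φ hden]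
    rcases Finset.mem_union.mp hz with hz | hz
    · exact Finset.mem_union_left _ (Finset.mem_map.mpr ⟨z, hz, rfl⟩)
    · exact Finset.mem_union_right _ (Finset.mem_map.mpr ⟨z, hz, rfl⟩)
  avoids := hf.avoids.of_ratFuncMapCoeffs φ hS
  rootOfUnity_at_critical := fun e he => by
    obtain ⟨n, hn, h⟩ :=
      hf.rootOfUnity_at_critical (φ e) (by rw [hS]; exact Finset.mem_map.mpr ⟨e, he, rfl⟩)
    refine ⟨n, hn, φ.injective ?_⟩
    rw [map_pow, map_one, ← eval_ratFuncMapCoeffs]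
    exact h

/-- **Base change along a field hom is an EQUIVALENCE on `κ`-coricity over algebraically closed
`Ω`** (geometric divisors): `ψ f` is `κ`-coric for the transported locus iff `f` is `κ`-coric.
[claim: Mochizuki2012, status: disputed] -/
theorem isKappaCoric_ratFuncMapCoeffs_iff [IsAlgClosed Ω] (φ : Ω →+* Ω')
    {S : CriticalLocus Ω} {S' : CriticalLocus Ω'} (hS : S'.pts = S.pts.map ⟨φ, φ.injective⟩)
    (f : RatFunc Ω) : S'.IsKappaCoric (ratFuncMapCoeffs φ f) ↔ S.IsKappaCoric f :=
  ⟨fun hf => hf.of_ratFuncMapCoeffs_of_splits φ hS (IsAlgClosed.splits _) (IsAlgClosed.splits _),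
    fun hf => hf.map_ratFuncMapCoeffs_of_splits φ hS (IsAlgClosed.splits _) (IsAlgClosed.splits _)⟩

/-- **GB-06, generic theorem (ruled name).** For algebraically closed `Ω ↪ Ω'` (precisely: `Ω`
algebraically closed, `Ω'` any field, both of characteristic `0`), a field hom `φ : Ω →+* Ω'` and
ANY ring hom `ψ : Ω(t) →+* Ω'(t)` with `ψ (C c) = C (φ c)`, `ψ X = X` (the shape of the sketch's
`BaseChangeSquare.ψ`): `IsKappaCoric S f → IsKappaCoric S' (ψ f)` for every transported locus
`S'.pts = φ (S.pts)` (e.g. `S' = critMap S φ`). [claim: Mochizuki2012, status: disputed] -/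
theorem isKappaCoric_map_of_isAlgClosed [IsAlgClosed Ω] {φ : Ω →+* Ω'}
    {ψ : RatFunc Ω →+* RatFunc Ω'}
    (hC : ∀ c : Ω, ψ (RatFunc.C c) = RatFunc.C (φ c)) (hX : ψ RatFunc.X = RatFunc.X)
    {S : CriticalLocus Ω} {S' : CriticalLocus Ω'} (hS : S'.pts = S.pts.map ⟨φ, φ.injective⟩)
    {f : RatFunc Ω} (hf : S.IsKappaCoric f) : S'.IsKappaCoric (ψ f) := by
  rw [ratFuncHom_eq_ratFuncMapCoeffs φ ψ hC hX]
  exact isKappaCoric_ratFuncMapCoeffs_of_isAlgClosed φ hS hf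

/-! ### `∞κ`-coric, `∞κ×`-coric, `κ`-solvable under base change (Rmk 3.1.7 (ii), (iii)) -/

/-- `∞κ`-coricity of a rational function is base-change stable over algebraically closed `Ω`
(`ψ (fⁿ) = (ψ f)ⁿ`). [claim: Mochizuki2012, status: disputed] -/
theorem isInftyKappaCoric_ratFuncMapCoeffs_of_isAlgClosed [IsAlgClosed Ω] (φ : Ω →+* Ω')
    {S : CriticalLocus Ω} {S' : CriticalLocus Ω'} (hS : S'.pts = S.pts.map ⟨φ, φ.injective⟩)
    {f : RatFunc Ω} (hf : S.IsInftyKappaCoric f) :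
    S'.IsInftyKappaCoric (ratFuncMapCoeffs φ f) := by
  obtain ⟨n, hn, h⟩ := hf
  exact ⟨n, hn, by rw [← map_pow]; exact isKappaCoric_ratFuncMapCoeffs_of_isAlgClosed φ hS h⟩

/-- `∞κ×`-coricity is base-change stable over algebraically closed `Ω`, for any unit parameter
`U' ⊇ φ (U)` on the target side. [claim: Mochizuki2012, status: disputed] -/
theorem isInftyKappaUnitCoric_ratFuncMapCoeffs_of_isAlgClosed [IsAlgClosed Ω] (φ : Ω →+* Ω')
    {S : CriticalLocus Ω} {S' : CriticalLocus Ω'} (hS : S'.pts = S.pts.map ⟨φ, φ.injective⟩)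
    {U : Set Ω} {U' : Set Ω'} (hU : Set.MapsTo φ U U')
    {f : RatFunc Ω} (hf : S.IsInftyKappaUnitCoric U f) :
    S'.IsInftyKappaUnitCoric U' (ratFuncMapCoeffs φ f) := by
  obtain ⟨c, hc, h⟩ := hf
  refine ⟨φ c, hU hc, ?_⟩
  rw [← ratFuncMapCoeffs_C, ← map_mul]
  exact isInftyKappaCoric_ratFuncMapCoeffs_of_isAlgClosed φ hS h

/-- `κ`-solvability is base-change stable over algebraically closed `Ω`, for any parameter
`Fsol' ⊇ φ (Fsol)` on the target side. [claim: Mochizuki2012, status: disputed] -/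
theorem isKappaSolvable_ratFuncMapCoeffs_of_isAlgClosed [IsAlgClosed Ω] (φ : Ω →+* Ω')
    {S : CriticalLocus Ω} {S' : CriticalLocus Ω'} (hS : S'.pts = S.pts.map ⟨φ, φ.injective⟩)
    {Fsol : Set Ω} {Fsol' : Set Ω'} (hF : Set.MapsTo φ Fsol Fsol')
    {f : RatFunc Ω} (hf : S.IsKappaSolvable Fsol f) :
    S'.IsKappaSolvable Fsol' (ratFuncMapCoeffs φ f) := by
  obtain ⟨c, hc, hc0, g, hg, rfl⟩ := hf
  exact ⟨φ c, hF hc, (map_ne_zero φ).mpr hc0, ratFuncMapCoeffs φ g,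
    isInftyKappaCoric_ratFuncMapCoeffs_of_isAlgClosed φ hS hg, by rw [map_mul, ratFuncMapCoeffs_C]⟩

/-! ### The general `∞κ`-coric elements of `Λ ⊇ Ω(t)` under a compatible `ι : Λ → Λ'`
(clause (a) of [IUTchI] Example 5.4 (iv), GEOMETRIC typing) -/

/-- **GB-06, clause (a) unbundled (`ClauseAGeom` of the GAP-SIZING-B sketch, l.74), element
form.** Let `Λ ⊇ Ω(t)` and `Λ' ⊇ Ω'(t)` be fields and `ι : Λ →+* Λ'` a ring homomorphism
compatible with `ψ = ratFuncMapCoeffs φ` (`ι ∘ algebraMap = algebraMap ∘ ψ`; e.g. GB-03's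
`RatBaseChange.iota φ` by `iota_algebraMap` — the restriction of Kummer classes `ι_v`). Over
algebraically closed `Ω`, an `∞κ`-coric element `x ∈ Λ` (`xⁿ = g`, `g` `κ`-coric) maps to an
`∞κ`-coric element `ι x ∈ Λ'` for the transported locus: "the poly-morphism is compatible with the
`∞κ`-coric structures", [IUTchI] Ex. 5.4 (iv) p. 149, membership half.
[claim: Mochizuki2012, status: disputed] -/
theorem isInftyKappaCoricIn_map_of_isAlgClosed [IsAlgClosed Ω] (φ : Ω →+* Ω')
    {S : CriticalLocus Ω} {S' : CriticalLocus Ω'} (hS : S'.pts = S.pts.map ⟨φ, φ.injective⟩)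
    {Λ : Type w} {Λ' : Type w'} [Field Λ] [Field Λ'] [Algebra (RatFunc Ω) Λ]
    [Algebra (RatFunc Ω') Λ'] (ι : Λ →+* Λ')
    (hι : ∀ g : RatFunc Ω, ι (algebraMap (RatFunc Ω) Λ g) =
      algebraMap (RatFunc Ω') Λ' (ratFuncMapCoeffs φ g))
    {x : Λ} (hx : S.IsInftyKappaCoricIn Λ x) : S'.IsInftyKappaCoricIn Λ' (ι x) := by
  obtain ⟨n, hn, g, hg, hxn⟩ := hx
  exact ⟨n, hn, ratFuncMapCoeffs φ g, isKappaCoric_ratFuncMapCoeffs_of_isAlgClosed φ hS hg,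
    by rw [← map_pow, hxn, hι]⟩

/-- The `∞κ×`-coric elements of `Λ` are likewise carried into those of `Λ'`, for unit parameters
`U' ⊇ φ (U)` (`‡𝕄_{∞κ×v}` side of clause (a)). [claim: Mochizuki2012, status: disputed] -/
theorem isInftyKappaUnitCoricIn_map_of_isAlgClosed [IsAlgClosed Ω] (φ : Ω →+* Ω')
    {S : CriticalLocus Ω} {S' : CriticalLocus Ω'} (hS : S'.pts = S.pts.map ⟨φ, φ.injective⟩)
    {Λ : Type w} {Λ' : Type w'} [Field Λ] [Field Λ'] [Algebra (RatFunc Ω) Λ]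
    [Algebra (RatFunc Ω') Λ'] (ι : Λ →+* Λ')
    (hι : ∀ g : RatFunc Ω, ι (algebraMap (RatFunc Ω) Λ g) =
      algebraMap (RatFunc Ω') Λ' (ratFuncMapCoeffs φ g))
    {U : Set Ω} {U' : Set Ω'} (hU : Set.MapsTo φ U U')
    {x : Λ} (hx : S.IsInftyKappaUnitCoricIn Λ U x) : S'.IsInftyKappaUnitCoricIn Λ' U' (ι x) := by
  obtain ⟨c, hc, h⟩ := hx
  refine ⟨φ c, hU hc, ?_⟩
  rw [← ratFuncMapCoeffs_C, ← hι, ← map_mul]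
  exact isInftyKappaCoricIn_map_of_isAlgClosed φ hS ι hι h

/-- The `κ`-solvable elements of `Λ` are carried into those of `Λ'`, for parameters
`Fsol' ⊇ φ (Fsol)`. [claim: Mochizuki2012, status: disputed] -/
theorem isKappaSolvableIn_map_of_isAlgClosed [IsAlgClosed Ω] (φ : Ω →+* Ω')
    {S : CriticalLocus Ω} {S' : CriticalLocus Ω'} (hS : S'.pts = S.pts.map ⟨φ, φ.injective⟩)
    {Λ : Type w} {Λ' : Type w'} [Field Λ] [Field Λ'] [Algebra (RatFunc Ω) Λ]
    [Algebra (RatFunc Ω') Λ'] (ι : Λ →+* Λ')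
    (hι : ∀ g : RatFunc Ω, ι (algebraMap (RatFunc Ω) Λ g) =
      algebraMap (RatFunc Ω') Λ' (ratFuncMapCoeffs φ g))
    {Fsol : Set Ω} {Fsol' : Set Ω'} (hF : Set.MapsTo φ Fsol Fsol')
    {x : Λ} (hx : S.IsKappaSolvableIn Λ Fsol x) : S'.IsKappaSolvableIn Λ' Fsol' (ι x) := by
  obtain ⟨c, hc, hc0, g, hg, rfl⟩ := hx
  exact ⟨φ c, hF hc, (map_ne_zero φ).mpr hc0, ι g,
    isInftyKappaCoricIn_map_of_isAlgClosed φ hS ι hι hg, by rw [map_mul, hι, ratFuncMapCoeffs_C]⟩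

/-- **GB-06, clause (a) as a `Set.MapsTo` statement (the body of the sketch's `ClauseAGeom S B`):**
for algebraically closed `Ω`, a field hom `φ : Ω →+* Ω'`, ANY `ψ : Ω(t) →+* Ω'(t)` with
`ψ (C c) = C (φ c)`, `ψ X = X`, and ANY `ι : Λ →+* Λ'` over `ψ` (the fields `φ, ψ, ψ_C, ψ_X, ι,
ι_comm` of a base-change square), `ι` carries the `∞κ`-coric SET of `Λ` (`†𝕄_{∞κ}` at the model,
GB-01's `infKappaCoricSetIn S Λ = {x | S.IsInftyKappaCoricIn Λ x}`) into the `∞κ`-coric set of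
`Λ'` for the transported locus (`‡𝕄_{∞κv}`; `(critMap S φ).pts = φ (S.pts)`).
[claim: Mochizuki2012, status: disputed] -/
theorem mapsTo_isInftyKappaCoricIn_of_isAlgClosed [IsAlgClosed Ω] {φ : Ω →+* Ω'}
    {ψ : RatFunc Ω →+* RatFunc Ω'}
    (hC : ∀ c : Ω, ψ (RatFunc.C c) = RatFunc.C (φ c)) (hX : ψ RatFunc.X = RatFunc.X)
    {S : CriticalLocus Ω} {S' : CriticalLocus Ω'} (hS : S'.pts = S.pts.map ⟨φ, φ.injective⟩)
    {Λ : Type w} {Λ' : Type w'} [Field Λ] [Field Λ'] [Algebra (RatFunc Ω) Λ]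
    [Algebra (RatFunc Ω') Λ'] (ι : Λ →+* Λ')
    (hι : ∀ g : RatFunc Ω, ι (algebraMap (RatFunc Ω) Λ g) = algebraMap (RatFunc Ω') Λ' (ψ g)) :
    Set.MapsTo ι {x : Λ | S.IsInftyKappaCoricIn Λ x} {y : Λ' | S'.IsInftyKappaCoricIn Λ' y} := by
  have hψ := ratFuncHom_eq_ratFuncMapCoeffs φ ψ hC hX
  subst hψ
  exact fun _ hx => isInftyKappaCoricIn_map_of_isAlgClosed φ hS ι hι hx

end KappaCoric

end CriticalLocus

/-! ### Clause (a) at the landed MODEL objects: GB-01's `∞κ`-coric sets and GB-03's `ι = iota φ` -/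

namespace RatBaseChange

variable {L : Type u} {L' : Type v} [Field L] [Field L'] [CharZero L] [CharZero L']

/-- **Clause (a) of [IUTchI] Ex. 5.4 (iv) at the model of record (GB-01 ★ p666587 + GB-03 ★ p666954),
geometric divisors (RULINGS #318):** for an algebraically closed constant field `L` (e.g. `L = F̄`)
and a field hom `φ : L →+* L'` (e.g. into an algebraic closure of `K_v`), GB-03's carrier map
`ι = iota φ : Λ_L → Λ_{L'}` («restriction of associated Kummer classes», `resKummer`) carries the
`∞κ`-coric set `†𝕄^⊛_{∞κ} = S.infKappaCoricSetIn Λ_L` INTO `‡𝕄_{∞κv} = S'.infKappaCoricSetIn Λ_{L'}`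
for the transported strictly critical locus `S'.pts = φ (S.pts)`.
[claim: Mochizuki2012, status: disputed] -/
theorem mapsTo_iota_infKappaCoricSetIn [IsAlgClosed L] (φ : L →+* L') {S : CriticalLocus L}
    {S' : CriticalLocus L'} (hS : S'.pts = S.pts.map ⟨φ, φ.injective⟩) :
    Set.MapsTo (iota φ) (S.infKappaCoricSetIn (AlgebraicClosure (RatFunc L)))
      (S'.infKappaCoricSetIn (AlgebraicClosure (RatFunc L'))) :=
  fun _ hx => CriticalLocus.isInftyKappaCoricIn_map_of_isAlgClosed φ hS (iota φ)
    (iota_algebraMap φ) hx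

/-- The same for the `∞κ×`-coric sets (`‡𝕄_{∞κ×v}` side of clause (a)), for unit parameters
`U' ⊇ φ (U)`. [claim: Mochizuki2012, status: disputed] -/
theorem mapsTo_iota_infKappaUnitCoricSetIn [IsAlgClosed L] (φ : L →+* L') {S : CriticalLocus L}
    {S' : CriticalLocus L'} (hS : S'.pts = S.pts.map ⟨φ, φ.injective⟩) {U : Set L} {U' : Set L'}
    (hU : Set.MapsTo φ U U') :
    Set.MapsTo (iota φ) (S.infKappaUnitCoricSetIn (AlgebraicClosure (RatFunc L)) U)
      (S'.infKappaUnitCoricSetIn (AlgebraicClosure (RatFunc L')) U') :=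
  fun _ hx => CriticalLocus.isInftyKappaUnitCoricIn_map_of_isAlgClosed φ hS (iota φ)
    (iota_algebraMap φ) hU hx

/-- Clause (a) lands inside `‡𝕄_{∞κv} ⊆ ‡𝕄_{∞κ×v}`: composing with GB-01's inclusion of the
`∞κ`-coric set in the `∞κ×`-coric set (any unit parameter `U' ∋ 1`).
[claim: Mochizuki2012, status: disputed] -/
theorem mapsTo_iota_infKappaCoricSetIn_infKappaUnitCoricSetIn [IsAlgClosed L] (φ : L →+* L')
    {S : CriticalLocus L} {S' : CriticalLocus L'} (hS : S'.pts = S.pts.map ⟨φ, φ.injective⟩)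
    {U' : Set L'} (hU' : (1 : L') ∈ U') :
    Set.MapsTo (iota φ) (S.infKappaCoricSetIn (AlgebraicClosure (RatFunc L)))
      (S'.infKappaUnitCoricSetIn (AlgebraicClosure (RatFunc L')) U') :=
  (mapsTo_iota_infKappaCoricSetIn φ hS).mono_right
    (S'.infKappaCoricSetIn_subset_infKappaUnitCoricSetIn hU')

end RatBaseChange

end Literature.IUT.HodgeTheaters
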